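import Summits.QuantumFields.YangMills.Theorems.UnitScaleTiltToronGaugeSpreadStep
import HarnessLib

/-!
# `UnitScaleTiltToronGaugeSpread` — THE SPREAD TORON GAUGE: small plaquettes on the whole torus ⇒ ONE gauge in which EVERY bond is within
# `13^d·(A + δ + 5·12^d·(B + 2t)∕N)` of the toron `b ↦ diag(e^{iθ_μ∕N}, e^{−iθ_μ∕N})` — all terms `∝ η` in the (α)(a)∕(b) member, as `ym-ust-19200-w5` g14's η-count asks
# (route `UnitScaleTilt`, crux K1′ `MinimiserStabilityRegPr` stmt-QuantumFields-19200, small-member exit (α)(a)∕(b), piece P3 «`RegPr` ↦ toron gauge», FILE 4b-2)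

Cell `ym3-torus` (YM ladder rung R3 = continuum SU(2) Yang–Mills on T³ — a RUNG, NOT the Clay problem: not d = 4, not infinite volume,
not a mass gap); width seat `ym3-torus-px19` (gen 12); helper `--supports stmt-QuantumFields-19200`.  THEOREMS ONLY (0 `def`, 0 `sorry`, default heartbeats except ONE decl-local `maxHeartbeats 400000`).

* §1 ★★`spreading_iterate` — ✓`ToronGaugeSpreadStep.spreading_step` iterated (gauges composed by lit ✓`T4AvgDerivBound.gaugeAct_gaugeAct`) along a duplicate-free list of directions: from «non-wrap-or-treated bonds `β`-near, untreated wrap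
  bonds `ω`-near, `12^{|l|}·ω ≤ 1∕2`» to «everything treated within `13^{|l|}·(β + δ_p + 5·12^{|l|}·ω∕N)`, the still-untreated wrap bonds within `12^{|l|}·ω`»; the gauges compose pointwise.
* §2 ★★★`exists_toron_gauge_spread` — docking to ✓`ToronGauge.exists_toron_gauge` (FILE 3: `A = (d−1)(N−1)δ`, `B = 2(d−1)(N−1)(δ+2A)`, `C = δ + 2(N−1)(δ+2A) ≤ t³`): for
  `U : GaugeField P j SU(2)`, `PlaqSmall δ U`, `12^d·(B + 2t) ≤ 1∕2`: `∃ σ θ`, `|θ_μ| ≤ π`, `U^σ` `δ`-flat and **for EVERY bond** `dist1 (U^σ b · D(θ_{b.dir}∕N)⁻¹) ≤ 13^d·(A + δ + 5·12^d·(B + 2t)∕N)`.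
  Member `(F, n, K)`: `N = 2L^{m+n}·η⁻¹`, `δ = ε₀η²`: `A ≈ 4ε₀L^{m+n}·η`, `δ = ε₀η²`, `(B+2t)∕N = O((ε₀L^{2(m+n)})^{1∕3})·η∕(2L^{m+n})` — EVERY TERM `∝ η` with a K-free coefficient
  that `→ 0` with `ε₀`; hence `(η⁻¹δ_b)² → 0` in the (α)(b) comparison rows.

HONEST SCOPE.  Lattice + compact-group bookkeeping over FILES 1–4b-1 and w5 g14's ✓`SU2FractionalPowers`; nothing of (α)(a)'s twisted coercivity, the (α)(b) comparison rows, `hT`, `hGF`, EX,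
`MinimiserStabilityRegPr` (19200) or the rung `YM3TorusSU2` is proved; no summit statement is proved; the Yang–Mills mass gap is NOT proved.
References: [Balaban1985Averaging] (8)–(9) p. 19, (19) p. 21, p. 24; [BrockerTomDieck1985] IV (2.2).
-/

noncomputable section

set_option autoImplicit false

open Quaternion NormedSpace
open Literature.MathematicalPhysics.QuantumLattice (su2Quat quatToSU2)
open Literature.MathematicalPhysics.QuantumFieldTheory.Balaban1983to89
open Literature.MathematicalPhysics.QuantumFieldTheory.Balaban1983to89.T4CubeChartGnomonic (SU2)
open Literature.MathematicalPhysics.QuantumFieldTheory.Balaban1983to89.T4ReTrLipUnitary (plaqSmall_gaugeAct_iff)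
open Summit.QuantumFields.YangMills.Theorems.ToronGauge (exists_toron_gauge)
open Summit.QuantumFields.YangMills.Theorems.ToronGaugeSpreadStep (spreading_step)
open Literature.MathematicalPhysics.QuantumFieldTheory.Balaban1983to89.T4AvgDerivBound (gaugeAct_gaugeAct)

namespace Summit.QuantumFields.YangMills.Theorems.ToronGaugeSpread

variable {P : Params} {j : ℕ}

/-! ## §1 Iterating the one-direction step over a list of directions -/

/-! Gauge algebra BY NAME: lit ✓`T4AvgDerivBound.gaugeAct_gaugeAct` (`(V^{v})^{u} = V^{u·v}`); the trivial gauge is handled inline. -/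

set_option maxHeartbeats 400000 in
/-- ★★ **THE ITERATION.**  Along a duplicate-free list `l` of directions disjoint from the treated set `T`: if the non-wrap-or-treated bonds are `β`-near the toron, the untreated
wrap bonds `ω`-near and `12^{|l|}·ω ≤ 1∕2`, then after `|l|` spreading steps (✓`spreading_step`, gauges composed pointwise) every bond that is non-wrap or of a direction in
`T` or in `l` is within `13^{|l|}·(β + δ_p + 5·12^{|l|}·ω∕N)` and every wrap bond of a direction outside `T` and `l` is within `12^{|l|}·ω`.
[cite: Balaban1985Averaging, (8)-(9) p.19, (19) p.21] -/
theorem spreading_iterate (θ : Fin P.d → ℝ) (hθ : ∀ κ, |θ κ| ≤ Real.pi) {δp : ℝ} (hδp : 0 ≤ δp) :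
    ∀ (l : List (Fin P.d)) (T : Finset (Fin P.d)), l.Nodup → (∀ μ ∈ l, μ ∉ T) →
      ∀ (V : GaugeField P j SU2) (β ω : ℝ), 0 ≤ β → 0 ≤ ω → (12 : ℝ) ^ l.length * ω ≤ 1 / 2 →
        PlaqSmall δp V →
        (∀ b : PBond P j, (b.src b.dir ≠ -1 ∨ b.dir ∈ T) →
          dist1 (V b * (quatToSU2 ⟨Real.cos (θ b.dir / P.sitesPerDir j), Real.sin (θ b.dir / P.sitesPerDir j), 0, 0⟩)⁻¹) ≤ β) →
        (∀ b : PBond P j, b.src b.dir = -1 → b.dir ∉ T →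
          dist1 (V b * (quatToSU2 ⟨Real.cos (θ b.dir / P.sitesPerDir j), Real.sin (θ b.dir / P.sitesPerDir j), 0, 0⟩)⁻¹) ≤ ω) →
        ∃ g : GaugeTransf P j SU2,
          PlaqSmall δp (GaugeField.gaugeAct g V) ∧
          (∀ b : PBond P j, (b.src b.dir ≠ -1 ∨ b.dir ∈ T ∨ b.dir ∈ l) →
            dist1 (GaugeField.gaugeAct g V b
                * (quatToSU2 ⟨Real.cos (θ b.dir / P.sitesPerDir j), Real.sin (θ b.dir / P.sitesPerDir j), 0, 0⟩)⁻¹)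
              ≤ (13 : ℝ) ^ l.length * (β + δp + 5 * (12 : ℝ) ^ l.length * ω / P.sitesPerDir j)) ∧
          (∀ b : PBond P j, b.src b.dir = -1 → b.dir ∉ T → b.dir ∉ l →
            dist1 (GaugeField.gaugeAct g V b
                * (quatToSU2 ⟨Real.cos (θ b.dir / P.sitesPerDir j), Real.sin (θ b.dir / P.sitesPerDir j), 0, 0⟩)⁻¹)
              ≤ (12 : ℝ) ^ l.length * ω) := by
  intro l
  induction l with
  | nil =>
    intro T _ _ V β ω hβ hω _ hV hgood hwrap
    have gaugeAct_one : GaugeField.gaugeAct (fun _ => (1 : SU2)) V = V := by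
      funext b; simp only [GaugeField.gaugeAct, one_mul, inv_one, mul_one]
    refine ⟨fun _ => 1, by rw [gaugeAct_one]; exact hV, ?_, ?_⟩
    · intro b hb
      rw [gaugeAct_one]
      have hb' : b.src b.dir ≠ -1 ∨ b.dir ∈ T := by
        rcases hb with h | h | h
        · exact Or.inl h
        · exact Or.inr h
        · simp at h
      refine (hgood b hb').trans ?_
      have : 0 ≤ ω / P.sitesPerDir j := by positivity
      simp only [List.length_nil, pow_zero, one_mul]
      have : 5 * 1 * ω / (P.sitesPerDir j : ℝ) = 5 * (ω / P.sitesPerDir j) := by ring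
      linarith
    · intro b hb hT _
      rw [gaugeAct_one]
      simpa using hwrap b hb hT
  | cons μ l ih =>
    intro T hnd hdisj V β ω hβ hω hsmall hV hgood hwrap
    have hμT : μ ∉ T := hdisj μ (by simp)
    have hμl : μ ∉ l := (List.nodup_cons.mp hnd).1
    have hnd' : l.Nodup := (List.nodup_cons.mp hnd).2
    have hN0 : (0 : ℝ) < (P.sitesPerDir j : ℝ) := by
      have h : 1 ≤ P.L ^ (P.m + P.K - j) := Nat.one_le_pow _ _ P.L_pos
      have : 2 ≤ P.sitesPerDir j := by show 2 ≤ 2 * P.L ^ (P.m + P.K - j); omega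
      positivity
    have h12 : (1 : ℝ) ≤ (12 : ℝ) ^ l.length := one_le_pow₀ (by norm_num)
    have h13 : (1 : ℝ) ≤ (13 : ℝ) ^ l.length := one_le_pow₀ (by norm_num)
    have hlen : ((μ :: l).length : ℕ) = l.length + 1 := List.length_cons
    rw [hlen, pow_succ] at hsmall
    have hω2 : ω ≤ 1 / 2 := by nlinarith
    -- the step at `μ`
    obtain ⟨g₁, hV₁, hgood₁, hwrap₁⟩ := spreading_step V θ μ T hμT hδp hβ hω hω2 hθ hV hgood hwrap
    -- the remaining directions, from the state `(insert μ T, 13β + 6δp + 51ω∕N, 12ω)`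
    have hdisj' : ∀ ν ∈ l, ν ∉ insert μ T := fun ν hν h => by
      rcases Finset.mem_insert.mp h with h | h
      · exact hμl (h ▸ hν)
      · exact hdisj ν (List.mem_cons_of_mem μ hν) h
    have hβ₁ : 0 ≤ 13 * β + 6 * δp + 51 * ω / P.sitesPerDir j := by positivity
    have hω₁ : 0 ≤ 12 * ω := by positivity
    have hsmall₁ : (12 : ℝ) ^ l.length * (12 * ω) ≤ 1 / 2 := by linarith
    obtain ⟨g₂, hV₂, hgood₂, hwrap₂⟩ :=
      ih (insert μ T) hnd' hdisj' (GaugeField.gaugeAct g₁ V) _ _ hβ₁ hω₁ hsmall₁ hV₁ hgood₁ hwrap₁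
    refine ⟨fun x => g₂ x * g₁ x, ?_, ?_, ?_⟩
    · rw [← gaugeAct_gaugeAct]; exact hV₂
    · intro b hb
      rw [← gaugeAct_gaugeAct]
      have hb' : b.src b.dir ≠ -1 ∨ b.dir ∈ insert μ T ∨ b.dir ∈ l := by
        rcases hb with h | h | h
        · exact Or.inl h
        · exact Or.inr (Or.inl (Finset.mem_insert_of_mem h))
        · rcases List.mem_cons.mp h with h | h
          · exact Or.inr (Or.inl (h ▸ Finset.mem_insert_self μ T))
          · exact Or.inr (Or.inr h)
      refine (hgood₂ b hb').trans ?_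
      rw [hlen, pow_succ, pow_succ]
      -- `13^n·(13β + 6δp + 51ω∕N + δp + 5·12^n·12ω∕N) ≤ 13^n·13·(β + δp + 5·12^n·12·ω∕N)`
      have hωN : 0 ≤ ω / P.sitesPerDir j := by positivity
      have key : 13 * β + 6 * δp + 51 * ω / P.sitesPerDir j + δp + 5 * (12 : ℝ) ^ l.length * (12 * ω) / P.sitesPerDir j
          ≤ 13 * (β + δp + 5 * ((12 : ℝ) ^ l.length * 12) * ω / P.sitesPerDir j) := by
        have e1 : 51 * ω / (P.sitesPerDir j : ℝ) = 51 * (ω / P.sitesPerDir j) := by ring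
        have e2 : 5 * (12 : ℝ) ^ l.length * (12 * ω) / P.sitesPerDir j = 60 * (12 : ℝ) ^ l.length * (ω / P.sitesPerDir j) := by ring
        have e3 : 13 * (β + δp + 5 * ((12 : ℝ) ^ l.length * 12) * ω / P.sitesPerDir j)
            = 13 * β + 13 * δp + 780 * (12 : ℝ) ^ l.length * (ω / P.sitesPerDir j) := by ring
        rw [e1, e2, e3]
        nlinarith
      calc (13 : ℝ) ^ l.length * (13 * β + 6 * δp + 51 * ω / P.sitesPerDir j + δp + 5 * (12 : ℝ) ^ l.length * (12 * ω) / P.sitesPerDir j)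
          ≤ (13 : ℝ) ^ l.length * (13 * (β + δp + 5 * ((12 : ℝ) ^ l.length * 12) * ω / P.sitesPerDir j)) :=
            mul_le_mul_of_nonneg_left key (by positivity)
        _ = (13 : ℝ) ^ l.length * 13 * (β + δp + 5 * ((12 : ℝ) ^ l.length * 12) * ω / P.sitesPerDir j) := by ring
    · intro b hb hT hl
      rw [← gaugeAct_gaugeAct]
      have hμb : b.dir ≠ μ := fun h => hl (h ▸ List.mem_cons_self)
      have hT' : b.dir ∉ insert μ T := fun h => by
        rcases Finset.mem_insert.mp h with h | h
        · exact hμb h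
        · exact hT h
      have hl' : b.dir ∉ l := fun h => hl (List.mem_cons_of_mem μ h)
      refine (hwrap₂ b hb hT' hl').trans ?_
      rw [hlen, pow_succ]
      nlinarith

/-! ## §2 Docking to the toron gauge of FILE 3 -/

/-- ★★★ **THE SPREAD TORON GAUGE.**  For `U : GaugeField P j SU(2)` with `PlaqSmall δ U` (`0 ≤ δ`), `N = sitesPerDir j`, `A := (d−1)(N−1)δ`, `B := 2(d−1)(N−1)(δ+2A)`,
`C := δ + 2(N−1)(δ+2A)`, any `t ≥ 0` with `C ≤ t³` and the smallness `12^d·(B + 2t) ≤ 1∕2`: there are a gauge `σ` and angles `|θ_μ| ≤ π` with `U^σ` `δ`-flat and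
**every** bond within `13^d·(A + δ + 5·12^d·(B + 2t)∕N)` of the toron `b ↦ D(θ_{b.dir}∕N) = diag(e^{iθ_μ∕N}, e^{−iθ_μ∕N})`.  (✓`exists_toron_gauge`, then ✓`spreading_iterate` along
`List.finRange d` from `T = ∅`.) [cite: Balaban1985Averaging, (8)-(9) p.19, (19) p.21, p.24] -/
theorem exists_toron_gauge_spread (U : GaugeField P j SU2) {δ t : ℝ} (hδ : 0 ≤ δ) (ht : 0 ≤ t) (hU : PlaqSmall δ U)
    (hC : δ + 2 * (((P.sitesPerDir j - 1 : ℕ) : ℝ) * (δ + 2 * (((P.d - 1 : ℕ) : ℝ) * ((P.sitesPerDir j - 1 : ℕ) : ℝ) * δ))) ≤ t ^ 3)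
    (hsmall : (12 : ℝ) ^ P.d * (2 * (((P.d - 1 : ℕ) : ℝ) * ((P.sitesPerDir j - 1 : ℕ) : ℝ)
                * (δ + 2 * (((P.d - 1 : ℕ) : ℝ) * ((P.sitesPerDir j - 1 : ℕ) : ℝ) * δ))) + 2 * t) ≤ 1 / 2) :
    ∃ (σ : GaugeTransf P j SU2) (θ : Fin P.d → ℝ),
      PlaqSmall δ (GaugeField.gaugeAct σ U) ∧ (∀ μ, |θ μ| ≤ Real.pi) ∧
      ∀ b : PBond P j,
        dist1 (GaugeField.gaugeAct σ U b
            * (quatToSU2 ⟨Real.cos (θ b.dir / P.sitesPerDir j), Real.sin (θ b.dir / P.sitesPerDir j), 0, 0⟩)⁻¹)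
          ≤ (13 : ℝ) ^ P.d * ((((P.d - 1 : ℕ) : ℝ) * ((P.sitesPerDir j - 1 : ℕ) : ℝ) * δ) + δ
              + 5 * (12 : ℝ) ^ P.d * (2 * (((P.d - 1 : ℕ) : ℝ) * ((P.sitesPerDir j - 1 : ℕ) : ℝ)
                  * (δ + 2 * (((P.d - 1 : ℕ) : ℝ) * ((P.sitesPerDir j - 1 : ℕ) : ℝ) * δ))) + 2 * t) / P.sitesPerDir j) := by
  obtain ⟨σ₀, θ, hflat, hθ, hnw, hw⟩ := exists_toron_gauge U hδ ht hU hC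
  have hA : 0 ≤ ((P.d - 1 : ℕ) : ℝ) * ((P.sitesPerDir j - 1 : ℕ) : ℝ) * δ := by positivity
  have hω : 0 ≤ 2 * (((P.d - 1 : ℕ) : ℝ) * ((P.sitesPerDir j - 1 : ℕ) : ℝ)
      * (δ + 2 * (((P.d - 1 : ℕ) : ℝ) * ((P.sitesPerDir j - 1 : ℕ) : ℝ) * δ))) + 2 * t := by positivity
  have hlen : (List.finRange P.d).length = P.d := List.length_finRange
  obtain ⟨g, hV, hgood, -⟩ := spreading_iterate θ hθ hδ (List.finRange P.d) ∅ (List.nodup_finRange P.d) (fun _ _ h => by simp at h)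
    (GaugeField.gaugeAct σ₀ U) _ _ hA hω (by rw [hlen]; exact hsmall) hflat
    (fun b hb => hnw b (hb.elim id fun h => absurd h (Finset.notMem_empty _)))
    (fun b hb _ => hw b hb)
  refine ⟨fun x => g x * σ₀ x, θ, ?_, hθ, fun b => ?_⟩
  · rw [← gaugeAct_gaugeAct]; exact hV
  · rw [← gaugeAct_gaugeAct]
    have hg := hgood b (Or.inr (Or.inr (List.mem_finRange b.dir)))
    rw [hlen] at hg
    exact hg

end Summit.QuantumFields.YangMills.Theorems.ToronGaugeSpread

end
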